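import Literature.AnabelianGeometry.SemiGraphs.UniversalCoveringOver

/-!
# The connected component of a point of a covering ([SemiAnbd] §3 p. 37)

For an object `T` of `B^cov(𝒢)` and a point `p` of `T`, the connected component of `p`
(`CovObj.SameComponent`, Def. 3.5 (ii) p. 37: "each connected component of `𝒢'`") is itself an
object `T.component p` of `B^cov(𝒢)` — the fibres are the points in the component, stable under the
constituent actions and the gluings — with the inclusion `T.componentι p : T.component p ⟶ T`.
If `T` is tempered, a finite covering `F` splitting the component at every point SPLITS the
object `T.component p` (`splits_component`), which is the form in which the universal property of
`𝒢_{∞,S}` (`liftHom`, global splitting hypothesis) applies to tempered coverings.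
-/

namespace Literature.AnabelianGeometry.SemiGraphs

namespace ProfiniteSemiGraph

open CategoryTheory

universe u

variable {𝒢 : ProfiniteSemiGraph.{u}} (T : CovObj 𝒢) (p : T.Point)

/-- The vertex fibre of the component of `p` over `v`: points of `T_v` in the component of `p`.
[cite: MochizukiSemiAnbd2006, Def 3.5(ii) p.37] -/
def CovObj.CompV (v : 𝒢.graph.Vertex) : Type u :=
  {x : (T.SV v).obj.V // T.SameComponent p (Sum.inl ⟨v, x⟩)}

/-- The edge fibre of the component of `p` over `e`. [cite: MochizukiSemiAnbd2006, Def 3.5(ii) p.37] -/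
def CovObj.CompE (e : 𝒢.graph.Edge) : Type u :=
  {y : (T.SE e).obj.V // T.SameComponent p (Sum.inr ⟨e, y⟩)}

/-- The component is stable under `Π_v`. [cite: MochizukiSemiAnbd2006, Def 3.5(ii) p.37] -/
theorem CovObj.sameComponent_ρV {v : 𝒢.graph.Vertex} (g : 𝒢.Gv v) (x : (T.SV v).obj.V)
    (hx : T.SameComponent p (Sum.inl ⟨v, x⟩)) :
    T.SameComponent p (Sum.inl ⟨v, (T.SV v).obj.ρ g x⟩) :=
  Relation.EqvGen.trans _ _ _ hx (Relation.EqvGen.rel _ _ (CovObj.Adj.vertex v g x))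

/-- The component is stable under `Π_e`. [cite: MochizukiSemiAnbd2006, Def 3.5(ii) p.37] -/
theorem CovObj.sameComponent_ρE {e : 𝒢.graph.Edge} (g : 𝒢.Ge e) (y : (T.SE e).obj.V)
    (hy : T.SameComponent p (Sum.inr ⟨e, y⟩)) :
    T.SameComponent p (Sum.inr ⟨e, (T.SE e).obj.ρ g y⟩) :=
  Relation.EqvGen.trans _ _ _ hy (Relation.EqvGen.rel _ _ (CovObj.Adj.edge e g y))

/-- The component is stable under the gluings. [cite: MochizukiSemiAnbd2006, Def 3.5(ii) p.37] -/
theorem CovObj.sameComponent_glue (b : 𝒢.graph.Branch) (v : 𝒢.graph.Vertex)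
    (h : 𝒢.graph.abuts b = some v) (y : (T.SE (𝒢.graph.edgeOf b)).obj.V)
    (hy : T.SameComponent p (Sum.inr ⟨_, y⟩)) :
    T.SameComponent p (Sum.inl ⟨v, (T.glue b v h).hom.hom.hom y⟩) :=
  Relation.EqvGen.trans _ _ _ hy (Relation.EqvGen.rel _ _ (CovObj.Adj.glue b v h y))

/-- … and under their inverses. [cite: MochizukiSemiAnbd2006, Def 3.5(ii) p.37] -/
theorem CovObj.sameComponent_glue_inv (b : 𝒢.graph.Branch) (v : 𝒢.graph.Vertex)
    (h : 𝒢.graph.abuts b = some v) (x : (T.SV v).obj.V)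
    (hx : T.SameComponent p (Sum.inl ⟨v, x⟩)) :
    T.SameComponent p (Sum.inr ⟨_, (T.glue b v h).inv.hom.hom x⟩) := by
  have h1 := CovObj.Adj.glue (S := T) b v h ((T.glue b v h).inv.hom.hom x)
  rw [T.glue_hom_inv] at h1
  exact Relation.EqvGen.trans _ _ _ hx (Relation.EqvGen.symm _ _ (Relation.EqvGen.rel _ _ h1))

/-- The vertex fibre of the component as a `Π_v`-set. [cite: MochizukiSemiAnbd2006, Def 3.5(ii) p.37] -/
def CovObj.compVAction (v : 𝒢.graph.Vertex) : Action (Type u) (𝒢.Gv v) where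
  V := T.CompV p v
  ρ :=
    { toFun := fun g => TypeCat.ofHom fun x : T.CompV p v =>
        (⟨(T.SV v).obj.ρ g x.1, T.sameComponent_ρV p g x.1 x.2⟩ : T.CompV p v)
      map_one' := by
        apply ConcreteCategory.hom_ext
        intro x
        apply Subtype.ext
        change (T.SV v).obj.ρ 1 x.1 = x.1
        rw [map_one]; rfl
      map_mul' := fun g g' => by
        apply ConcreteCategory.hom_ext
        intro x
        apply Subtype.ext
        change (T.SV v).obj.ρ (g * g') x.1 = (T.SV v).obj.ρ g ((T.SV v).obj.ρ g' x.1)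
        rw [map_mul]; rfl }

/-- The edge fibre of the component as a `Π_e`-set. [cite: MochizukiSemiAnbd2006, Def 3.5(ii) p.37] -/
def CovObj.compEAction (e : 𝒢.graph.Edge) : Action (Type u) (𝒢.Ge e) where
  V := T.CompE p e
  ρ :=
    { toFun := fun g => TypeCat.ofHom fun y : T.CompE p e =>
        (⟨(T.SE e).obj.ρ g y.1, T.sameComponent_ρE p g y.1 y.2⟩ : T.CompE p e)
      map_one' := by
        apply ConcreteCategory.hom_ext
        intro y
        apply Subtype.ext
        change (T.SE e).obj.ρ 1 y.1 = y.1
        rw [map_one]; rfl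
      map_mul' := fun g g' => by
        apply ConcreteCategory.hom_ext
        intro y
        apply Subtype.ext
        change (T.SE e).obj.ρ (g * g') y.1 = (T.SE e).obj.ρ g ((T.SE e).obj.ρ g' y.1)
        rw [map_mul]; rfl }

/-- The component fibres are tempered `Π`-sets (countable subsets, same stabilisers).
[cite: MochizukiSemiAnbd2006, Def 3.5(ii) p.37] -/
theorem CovObj.compVAction_mem (v : 𝒢.graph.Vertex) : temperedAction (𝒢.Gv v) (T.compVAction p v) := by
  haveI : Countable (T.SV v).obj.V := (T.SV v).property.1
  refine ⟨inferInstanceAs (Countable {x : (T.SV v).obj.V // _}), fun x => ?_⟩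
  have hx := (T.SV v).property.2 x.1
  have e : {g : 𝒢.Gv v | (T.compVAction p v).ρ g x = x} = {g : 𝒢.Gv v | (T.SV v).obj.ρ g x.1 = x.1} :=
    Set.ext fun g => ⟨fun h => congrArg Subtype.val h, fun h => Subtype.ext h⟩
  change IsOpen {g : 𝒢.Gv v | (T.compVAction p v).ρ g x = x}
  rw [e]
  exact hx

/-- Edge version. [cite: MochizukiSemiAnbd2006, Def 3.5(ii) p.37] -/
theorem CovObj.compEAction_mem (e : 𝒢.graph.Edge) : temperedAction (𝒢.Ge e) (T.compEAction p e) := by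
  haveI : Countable (T.SE e).obj.V := (T.SE e).property.1
  refine ⟨inferInstanceAs (Countable {y : (T.SE e).obj.V // _}), fun y => ?_⟩
  have hy := (T.SE e).property.2 y.1
  have h : {g : 𝒢.Ge e | (T.compEAction p e).ρ g y = y} = {g : 𝒢.Ge e | (T.SE e).obj.ρ g y.1 = y.1} :=
    Set.ext fun g => ⟨fun h => congrArg Subtype.val h, fun h => Subtype.ext h⟩
  change IsOpen {g : 𝒢.Ge e | (T.compEAction p e).ρ g y = y}
  rw [h]
  exact hy

/-- The gluing bijection of the component along `b`. [cite: MochizukiSemiAnbd2006, Def 3.5(ii) p.37] -/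
noncomputable def CovObj.compGlueEquiv (b : 𝒢.graph.Branch) (v : 𝒢.graph.Vertex)
    (h : 𝒢.graph.abuts b = some v) : T.CompE p (𝒢.graph.edgeOf b) ≃ T.CompV p v where
  toFun y := ⟨(T.glue b v h).hom.hom.hom y.1, T.sameComponent_glue p b v h y.1 y.2⟩
  invFun x := ⟨(T.glue b v h).inv.hom.hom x.1, T.sameComponent_glue_inv p b v h x.1 x.2⟩
  left_inv y := Subtype.ext (T.glue_inv_hom b v h y.1)
  right_inv x := Subtype.ext (T.glue_hom_inv b v h x.1)

/-- **The connected component of `p` as an object of `B^cov(𝒢)`.**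
[cite: MochizukiSemiAnbd2006, Def 3.5(ii) p.37] -/
noncomputable def CovObj.component : CovObj 𝒢 where
  SV v := ⟨T.compVAction p v, T.compVAction_mem p v⟩
  SE e := ⟨T.compEAction p e, T.compEAction_mem p e⟩
  glue b v h := (temperedAction (𝒢.Ge (𝒢.graph.edgeOf b))).isoMk
    (Action.mkIso (Equiv.toIso (T.compGlueEquiv p b v h)) fun g => by
      apply ConcreteCategory.hom_ext
      intro y
      apply Subtype.ext
      exact T.glue_ρ b v h g y.1)

/-- The inclusion of the component. [cite: MochizukiSemiAnbd2006, Def 3.5(ii) p.37] -/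
noncomputable def CovObj.componentι : T.component p ⟶ T where
  fV v := ObjectProperty.homMk
    { hom := TypeCat.ofHom fun x : T.CompV p v => x.1
      comm := fun _ => rfl }
  fE e := ObjectProperty.homMk
    { hom := TypeCat.ofHom fun y : T.CompE p e => y.1
      comm := fun _ => rfl }
  comm b v h := by
    apply ObjectProperty.hom_ext
    apply Action.Hom.ext
    apply ConcreteCategory.hom_ext
    intro y
    rfl

/-- A finite covering splitting `T` at every point of the component of `p` splits the object
`T.component p`. [cite: MochizukiSemiAnbd2006, Def 3.5(ii) p.37] -/
theorem CovObj.splits_component (F : CovObj 𝒢)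
    (hF : ∀ q : T.Point, T.SameComponent p q → F.SplitsAt T q) : F.Splits (T.component p) := by
  refine ⟨fun v x g hgx s => ?_, fun e x g hgx s => ?_⟩
  · apply Subtype.ext
    exact hF (Sum.inl ⟨v, s.1⟩) s.2 x g hgx
  · apply Subtype.ext
    exact hF (Sum.inr ⟨e, s.1⟩) s.2 x g hgx

/-- For a tempered `T`, every component is split by some finite covering with nonempty fibres.
[cite: MochizukiSemiAnbd2006, Def 3.5(ii) p.37] -/
theorem CovObj.exists_splits_component (hT : T.IsTempered) :
    ∃ F : CovObj 𝒢, F.IsFinite ∧ F.HasNonemptyFibres ∧ F.Splits (T.component p) := by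
  obtain ⟨F, hfin, hne, hsp⟩ := hT p
  exact ⟨F, hfin, hne, T.splits_component p F hsp⟩

/-- The point `p` itself lies in its component (vertex case): the base point of `T.component p`.
[cite: MochizukiSemiAnbd2006, Def 3.5(ii) p.37] -/
theorem CovObj.mem_component_self {v : 𝒢.graph.Vertex} (x : (T.SV v).obj.V) :
    T.SameComponent (Sum.inl ⟨v, x⟩) (Sum.inl ⟨v, x⟩) :=
  Relation.EqvGen.refl _

end ProfiniteSemiGraph

end Literature.AnabelianGeometry.SemiGraphs
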